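import Summits.BirchSwinnertonDyer.BirchSwinnertonDyer.Theorems.PrintCf2RubinValueTwoLinePushSpecialisation
import HarnessLib

/-!
# Route C `PrintCf2RubinValueTwo`, item `RestrictedMainConjWithValueAtTwo` (stmt-BirchSwinnertonDyer-23722, aside; v13 twin 24035
# `RestrictedMainConjGVAtTwo` closed) — scrit R114: the ONE-SIDED (SP)∘(RES) seam «`Ch_Λ(𝔛_nr) ≤ Ch_{Λ₂}(X₂)(T₁ ↦ 0)`» NEEDS NO S3n′

Cell `bsd-print-cf2`, width seat `bsd-line-cf2c-w3` g3 (prover-bsd-line-cf2c-w3-g3-0); `--supports stmt-BirchSwinnertonDyer-23722` (helper,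
Theses-free). Answers the stub-critic's R114 (STUB-PLAN v3.4 §4 for `stub_heegnerIndexLowerAtTwo`, crux 27851 `SplitBadTwoLowerHalfOfFacts`):
«expose the implication from the `⊆` clause ALONE to the GV-currency containment LOWER consumes, and SAY whether S3n′ (24037) is used on that side».
ANSWER, kernel-checked here: **NO** — the containment `charIdeal Λ D_nr.X ≤ (charIdeal Λ₂ D₂.X).map constantCoeff` holds for EVERY finitely
generated two-variable dual `D₂.X` and EVERY Greenberg–Vatsal datum `D_nr` on the line with `D_nr.X` `Λ`-torsion, with NO hypothesis on the
pseudo-null submodules of `D₂.X`. Mechanism: the tree's Herbrand specialisation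
`PowerSeriesSpecialization.charIdeal_quotSMulTop_eq_mul` (`ch_Λ(X ⧸ T₁X) = ch_Λ(X[T₁]) · (ch_{Λ₂} X)(T₁ ↦ 0)` under `T₁`-regularity only) — S3n′
served only to kill the junk factor `ch_Λ(X[T₁])` (-w5 g4 `map_constantCoeff_charIdeal_eq_of_pseudoNull_finite`), i.e. the OPPOSITE containment;
`T₁`-regularity itself follows from `Λ`-torsion of the datum on the line (cf2c-w8 g2 `LineTorsionRegularity.exists_constantCoeff_ne_zero_of_linePush`),
and the exact (RES) map `X₂ ⧸ T₁X₂ ↪ D_nr.X` with finite cokernel (cf2c-w2 g2 p687583) identifies the two characteristic ideals on the line.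
HONEST FRAMING: nothing here closes a crux or a registered stub; BSD is not proved by any of this; no summit statement is proved by this seat.
THEOREMS ONLY (no definition, no named fact, no `sorry`).

* §1 (pure algebra, any `p`): **`charIdeal_quotSMulTop_le_map_constantCoeff`** (`X` f.g. over `Λ₂`, `T₁`-regular ⟹ `ch_Λ(X ⧸ T₁X) ≤ (ch_{Λ₂} X)(T₁ ↦ 0)`),
  **`charIdeal_le_map_constantCoeff_of_linePush`** (the (RES) shape `f : X ⧸ T₁X ↪ Y`, finite cokernel, `Y` torsion ⟹ `ch_Λ(Y) ≤ (ch_{Λ₂} X)(T₁ ↦ 0)`).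
* §2 (generic `K`, `p`, `M`, pair with `ker κ₂ ⊓ I_v̄ ≤ ker κ₁`): **`charIdeal_unr_le_map_constantCoeff_of_inf_inertia_le`**.
* §3 (road α frames, `p = 2`, ANY partner `κ₁` of THE `v̄`-line `κ₂`): **`charIdeal_unr_le_map_constantCoeff_of_frame`** and the assembly
  **`exists_charGenerator_unr_le_of_frame`**: `Module.Finite Λ₂ D₂.X` ∧ `Finite (H¹_nr(K*_∞, W*)^{γ₂=1})` ⟹ `∃ H, Module.Finite ∧ IsTorsion ∧
  charIdeal Λ D_nr.X = span {H} ∧ H(0) ≠ 0 ∧ span {H} ≤ (charIdeal Λ₂ D₂.X).map constantCoeff` — the one-sided twin of cf2c-w8 g2's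
  `LinePush.exists_charGenerator_unr_of_frame` with its S3n′ hypothesis `hfin` DELETED.
presearch: Bourbaki AC VII §4.5; Skinner–Urban 2014 §3.1.6 / Cor. 3.2.9 (i) (the one-sided corollary); Ochiai 2006 Lemma 7.2; Delbourgo 2008 Lemma 10.5 —
tree algebra (`charIdeal_quotSMulTop_eq_mul`); no new fact. beyond-print theorem: no.

References: [SkinnerUrban2014] §3.1.6, Cor. 3.2.9; [GreenbergVatsal2000] §2 pp. 17–21; [GreenbergLNM1716] §4 Lemma 4.2; [Washington1997] §13.2;
Bourbaki AC VII §4.4–4.5.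
-/

noncomputable section

open Function
open scoped Classical Pointwise

-- D-0017: single-problem summit, the namespace repeats the problem name by design.
set_option linter.dupNamespace false
set_option autoImplicit false

open NumberField IsDedekindDomain Field WeierstrassCurve
open Literature.NumberTheory.EllipticCurves Literature.NumberTheory.EllipticCurves.Module
open Literature.NumberTheory.EllipticCurves.GreenbergSelmer
open Literature.NumberTheory.EllipticCurves.GreenbergVatsal2000 Literature.NumberTheory.EllipticCurves.KellerYin2024
open Literature.NumberTheory.EllipticCurves.IwasawaDual
open Literature.NumberTheory.GaloisRepresentations
open Summit.BirchSwinnertonDyer.BirchSwinnertonDyer.Theorems.SignedBaseChangeAcDivSpecialization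
open Summit.BirchSwinnertonDyer.BirchSwinnertonDyer.Theorems.SignedBaseChangeAcDivSpecialization.PowerSeriesSpecialization
open Summit.BirchSwinnertonDyer.BirchSwinnertonDyer.Theorems.IwasawaTwoVariable
open Summit.BirchSwinnertonDyer.BirchSwinnertonDyer.Theorems.PrintCf2.RestrictedSelmerPair
open Summit.BirchSwinnertonDyer.BirchSwinnertonDyer.Theorems.PrintCf2.LineTorsionRegularity

universe u

namespace Summit.BirchSwinnertonDyer.BirchSwinnertonDyer.Theorems.PrintCf2.LinePushOneSided

/-! ## §1. Pure algebra: the one-sided Herbrand specialisation and its (RES) shape -/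

section Algebra

variable (p : ℕ) [Fact p.Prime] (X : Type*) [AddCommGroup X] [Module (IwasawaAlgebra₂ p) X]
  [Module.Finite (IwasawaAlgebra₂ p) X]

/-- **ONE-SIDED SPECIALISATION `T₁ ↦ 0`, NO PSEUDO-NULL HYPOTHESIS: `ch_Λ(X ⧸ T₁X) ≤ (ch_{Λ₂} X)(T₁ ↦ 0)`** for a finitely generated
`Λ₂ = ℤ_p⟦T₂⟧⟦T₁⟧`-module `X` killed by some `s` with `s(0) ≠ 0` (`T₁`-regularity); the `Λ = ℤ_p⟦T₂⟧`-structure on `X ⧸ T₁X` is the restriction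
along the constants `PowerSeries.C` (the cell's `Module.compHom` spelling). Immediate from the tree's Herbrand form
`charIdeal_quotSMulTop_eq_mul`: `ch_Λ(X ⧸ T₁X) = ch_Λ(X[T₁]) · (ch_{Λ₂} X)(T₁ ↦ 0)`, dropping the junk factor `ch_Λ(X[T₁])` (an ideal). The
OPPOSITE containment is the one that needs the junk factor to be `1`, i.e. S3n′ (-w5 g4 `TwoVarSpecializationFinite.map_constantCoeff_charIdeal_eq_of_pseudoNull_finite`).
[cite: SkinnerUrban2014, §3.1.6 and Cor. 3.2.9] [cite: Washington1997, §13.2] -/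
theorem charIdeal_quotSMulTop_le_map_constantCoeff
    (hs : ∃ s : IwasawaAlgebra₂ p, PowerSeries.constantCoeff s ≠ 0 ∧ ∀ m : X, s • m = 0) :
    letI : Module (IwasawaAlgebra p) (QuotSMulTop (PowerSeries.X : IwasawaAlgebra₂ p) X) :=
      Module.compHom _ (PowerSeries.C (R := IwasawaAlgebra p))
    charIdeal (IwasawaAlgebra p) (QuotSMulTop (PowerSeries.X : IwasawaAlgebra₂ p) X) ≤
      (charIdeal (IwasawaAlgebra₂ p) X).map (PowerSeries.constantCoeff (R := IwasawaAlgebra p)) := by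
  haveI : UniqueFactorizationMonoid (PowerSeries (IwasawaAlgebra p)) :=
    Literature.NumberTheory.IwasawaTheory.uniqueFactorizationMonoid_iwasawaAlgebraTwoVar p
  -- the constants algebra `C : Λ → Λ₂` (NOT Mathlib's default `algebraPowerSeries`, `T ↦ T₁`)
  let alg : Algebra (IwasawaAlgebra p) (PowerSeries (IwasawaAlgebra p)) :=
    @MvPowerSeries.instAlgebra Unit (IwasawaAlgebra p) (IwasawaAlgebra p) _ _ (Algebra.id _)
  letI : Module (IwasawaAlgebra p) X := Module.compHom X (PowerSeries.C (R := IwasawaAlgebra p))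
  have hIST : @IsScalarTower (IwasawaAlgebra p) (PowerSeries (IwasawaAlgebra p)) X alg.toSMul
      inferInstance inferInstance :=
    @IsScalarTower.mk _ _ _ alg.toSMul _ _ fun a r m => by
      rw [@Algebra.smul_def _ _ _ _ alg a r, mul_smul]
      rfl
  have hmul := @charIdeal_quotSMulTop_eq_mul (IwasawaAlgebra p) _ _ _ _ _ X _ _ _ _ hIST hs
  rw [hmul]
  exact Ideal.mul_le_left

variable {Y : Type*} [AddCommGroup Y] [Module (IwasawaAlgebra p) Y]

/-- **ONE-SIDED (SP)∘(RES), (RES) SHAPE — NO S3n′.** For `X` finitely generated over `Λ₂ = Λ⟦T₁⟧` and `f : X ⧸ T₁X →ₗ[Λ] Y` injective with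
finite cokernel (the exact (RES) map of cf2c-w8 g0 / cf2c-w2 g2): if `Y` is `Λ`-torsion then **`charIdeal Λ Y ≤ (charIdeal Λ₂ X).map constantCoeff`**.
Chain: `Y` torsion ⟹ `T₁`-regularity of `X` (`LineTorsionRegularity.exists_constantCoeff_ne_zero_of_linePush`) ⟹ one-sided Herbrand
(`charIdeal_quotSMulTop_le_map_constantCoeff`) ⟹ `ch(X ⧸ T₁X) = ch(Y)` (pseudo-isomorphism, `charIdeal_eq_of_injective_of_finite_quotient_range`).
The one-sided twin of cf2c-w8 g2's `charIdeal_eq_map_constantCoeff_of_linePush` with its hypothesis `hfin` (S3n′) deleted.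
[cite: SkinnerUrban2014, §3.1.6 and Cor. 3.2.9] [cite: GreenbergVatsal2000, §2 pp. 17–21] -/
theorem charIdeal_le_map_constantCoeff_of_linePush
    (f : letI : Module (IwasawaAlgebra p) (QuotSMulTop (PowerSeries.X : IwasawaAlgebra₂ p) X) :=
        Module.compHom _ (PowerSeries.C (R := IwasawaAlgebra p))
      QuotSMulTop (PowerSeries.X : IwasawaAlgebra₂ p) X →ₗ[IwasawaAlgebra p] Y)
    (hf : Function.Injective f)
    (hcoker : letI : Module (IwasawaAlgebra p) (QuotSMulTop (PowerSeries.X : IwasawaAlgebra₂ p) X) :=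
        Module.compHom _ (PowerSeries.C (R := IwasawaAlgebra p))
      Finite (Y ⧸ LinearMap.range f))
    (htor : Module.IsTorsion (IwasawaAlgebra p) Y) :
    charIdeal (IwasawaAlgebra p) Y ≤ (charIdeal (IwasawaAlgebra₂ p) X).map (PowerSeries.constantCoeff (R := IwasawaAlgebra p)) := by
  letI : Module (IwasawaAlgebra p) (QuotSMulTop (PowerSeries.X : IwasawaAlgebra₂ p) X) :=
    Module.compHom _ (PowerSeries.C (R := IwasawaAlgebra p))
  have hs := exists_constantCoeff_ne_zero_of_linePush p X f hf htor
  haveI := hcoker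
  rw [← charIdeal_eq_of_injective_of_finite_quotient_range p f hf]
  exact charIdeal_quotSMulTop_le_map_constantCoeff p X hs

end Algebra

/-! ## §2. Generic: any pair with `ker κ₂ ⊓ I_v̄ ≤ ker κ₁` -/

section Line

variable {K : Type u} [Field K] [NumberField K] {p : ℕ} [Fact p.Prime] {κ₁ κ₂ : ZpExtension K p}
  {M : Type u} [AddCommGroup M] [DistribMulAction (absoluteGaloisGroup K) M] [TopologicalSpace M] [DiscreteTopology M]
  {vbar : HeightOneSpectrum (𝓞 K)} {γ₁ γ₂ : absoluteGaloisGroup K}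

/-- **ONE-SIDED (SP)∘(RES) on a line, NO S3n′: `Ch_Λ(𝔛_nr) ≤ Ch_{Λ₂}(X₂)(T₁ ↦ 0)`** — for a pair with `ker κ₂ ⊓ I_v̄ ≤ ker κ₁`, ANY `D₂` with `D₂.X`
finitely generated over `Λ₂`, ANY Greenberg–Vatsal datum `D_nr` on the line `κ₂` with `D_nr.X` `Λ`-torsion:
`charIdeal Λ D_nr.X ≤ (charIdeal Λ₂ D₂.X).map constantCoeff` (§1 on cf2c-w2 g2's exact map `exists_linearMap_quotSMulTop_unr_of_inf_inertia_le`).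
The one-sided twin of cf2c-w8 g2's `LinePush.charIdeal_unr_eq_map_constantCoeff_of_inf_inertia_le`, hypothesis `hfin` deleted.
[cite: SkinnerUrban2014, Cor. 3.2.9] [cite: GreenbergVatsal2000, §2 pp. 17–21] -/
theorem charIdeal_unr_le_map_constantCoeff_of_inf_inertia_le (hγ : ZpExtension.IsTopGeneratorPair κ₁ κ₂ γ₁ γ₂)
    (hI : κ₂.kerSubgroup ⊓ inertia vbar ≤ κ₁.kerSubgroup)
    (htor : ∀ m : M, ∃ k : ℕ, p ^ k • m = 0)
    (hstab : ∀ m : M, IsOpen (MulAction.stabilizer (absoluteGaloisGroup K) m : Set (absoluteGaloisGroup K)))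
    (hcont : ∀ m : M, Continuous fun g : absoluteGaloisGroup K ↦ g • m)
    [Finite (FixedPoints.addSubgroup (ZpExtension.pairKer κ₁ κ₂) M ⧸ (ResKernel.subOne (ZpExtension.pairKer κ₁ κ₂) M γ₁).range)]
    (D₂ : DualData₂ κ₁ κ₂ M vbar γ₁ γ₂) [Module.Finite (IwasawaAlgebra₂ p) D₂.X]
    (D : DatumDualData κ₂ γ₂ M (Castella2018.AcSelmer.bdpData M p vbar) ∅)
    (hXtor : Module.IsTorsion (IwasawaAlgebra p) D.X) :
    Module.charIdeal (IwasawaAlgebra p) D.X ≤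
      (Module.charIdeal (IwasawaAlgebra₂ p) D₂.X).map (PowerSeries.constantCoeff (R := IwasawaAlgebra p)) := by
  letI : Module (IwasawaAlgebra p) (QuotSMulTop (PowerSeries.X : IwasawaAlgebra₂ p) D₂.X) :=
    Module.compHom _ (PowerSeries.C (R := IwasawaAlgebra p))
  obtain ⟨f, -, hinj, hfinc, -⟩ := LinePush.exists_linearMap_quotSMulTop_unr_of_inf_inertia_le hγ hI htor hstab hcont D₂ D
  exact charIdeal_le_map_constantCoeff_of_linePush p D₂.X f hinj hfinc hXtor

end Line

/-! ## §3. Road α frames (`p = 2`, ANY partner `κ₁` of the `v̄`-line `κ₂`) -/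

section Frame

variable {K : Type} [Field K] [NumberField K]

/-- **ONE-SIDED (SP)∘(RES) ON EVERY FRAME, ANY PARTNER, NO S3n′: `Ch_Λ(𝔛_nr) ≤ Ch_{Λ₂}(D₂.X)(T₁ ↦ 0)`** for THE `v̄`-line `κ₂` (unramified outside `v̄`),
ANY partner `κ₁`, ANY `D₂` with `D₂.X` finitely generated, ANY Greenberg–Vatsal datum `D_nr` with `D_nr.X` torsion (member `C • W = cm7^{(d)}`, `K`
imaginary quadratic, `2 = v v̄`, ANY `π, r`). The one-sided twin of cf2c-w8 g2's `LinePush.charIdeal_unr_eq_map_constantCoeff_of_frame`, `hfin` deleted.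
[cite: Agboola2007, §4, Thm. 2] [cite: SkinnerUrban2014, Cor. 3.2.9] [cite: GreenbergVatsal2000, §2 pp. 17–21] -/
theorem charIdeal_unr_le_map_constantCoeff_of_frame {d : ℤ} (hd0 : d ≠ 0) (W : WeierstrassCurve ℚ) [W.IsElliptic]
    (C : VariableChange ℚ) (hC : C • W = cm7.quadraticTwist (d : ℚ)) (hK : IsImaginaryQuadratic K)
    (v vbar : HeightOneSpectrum (𝓞 K)) (hv : ((2 : ℕ) : 𝓞 K) ∈ v.asIdeal) (hvbar : ((2 : ℕ) : 𝓞 K) ∈ vbar.asIdeal) (hne : vbar ≠ v)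
    (π : (W.baseChange K).endRing) (r : ℤ_[2]) (κ₁ κ₂ : ZpExtension K 2)
    (hκ₂ : κ₂.IsUnramifiedOutside vbar) {γ₁ γ₂ : absoluteGaloisGroup K} (hγ : ZpExtension.IsTopGeneratorPair κ₁ κ₂ γ₁ γ₂)
    (D₂ : DualData₂ κ₁ κ₂ ↥((W.baseChange K).endEigenPrimaryTorsion 2 π r) vbar γ₁ γ₂) [Module.Finite (IwasawaAlgebra₂ 2) D₂.X]
    (D : DatumDualData κ₂ γ₂ ↥((W.baseChange K).endEigenPrimaryTorsion 2 π r)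
      (Castella2018.AcSelmer.bdpData ↥((W.baseChange K).endEigenPrimaryTorsion 2 π r) 2 vbar) ∅)
    (hXtor : Module.IsTorsion (IwasawaAlgebra 2) D.X) :
    Module.charIdeal (IwasawaAlgebra 2) D.X ≤
      (Module.charIdeal (IwasawaAlgebra₂ 2) D₂.X).map (PowerSeries.constantCoeff (R := IwasawaAlgebra 2)) := by
  haveI hF : Finite (FixedPoints.addSubgroup (ZpExtension.pairKer κ₁ κ₂) ↥((W.baseChange K).endEigenPrimaryTorsion 2 π r)) :=
    LinePush.finite_fixedPoints_pairKer_of_frame_any hd0 W C hC hK π r κ₁ κ₂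
  haveI : Finite (FixedPoints.addSubgroup (ZpExtension.pairKer κ₁ κ₂) ↥((W.baseChange K).endEigenPrimaryTorsion 2 π r) ⧸
      (ResKernel.subOne (ZpExtension.pairKer κ₁ κ₂) ↥((W.baseChange K).endEigenPrimaryTorsion 2 π r) γ₁).range) := inferInstance
  exact charIdeal_unr_le_map_constantCoeff_of_inf_inertia_le hγ
    (LinePush.kerSubgroup_inf_inertia_le_of_isUnramifiedOutside_of_pair hK hv hvbar hne hγ hκ₂)
    (exists_pow_smul_endEigenPrimaryTorsion_eq_zero (W.baseChange K) 2 π r) (isOpen_stabilizer_endEigenPrimaryTorsion (W.baseChange K) 2 π r)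
    (continuous_smul_endEigenPrimaryTorsion (W.baseChange K) 2 π r) D₂ D hXtor

/-- **THE ONE-SIDED ALGEBRAIC SIDE OF S3b′ ON EVERY FRAME, modulo (TW) and ONE arithmetic input, NO S3n′.** For THE `v̄`-line `κ₂`, ANY partner `κ₁`,
ANY `D₂` with `D₂.X` finitely generated over `Λ₂` and ANY Greenberg–Vatsal datum `D_nr` on the line: IF `H¹_nr(K*_∞, W*)^{γ₂ = 1}` is finite (landed
hypothesis-free on the frames by cf2c-w2 g2 `UnrInvariants.finite_endInvariants_conjUnr_of_frame`) THEN `D_nr.X` is finitely generated and torsion,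
`charIdeal Λ D_nr.X = span {H}` with `H(0) ≠ 0` (Greenberg LNM 1716 Lemma 4.2, cf2c-w8 g2's read-out), and **`span {H} ≤ (charIdeal Λ₂ D₂.X).map constantCoeff`**.
The one-sided twin of cf2c-w8 g2's `LinePush.exists_charGenerator_unr_of_frame` with its S3n′ hypothesis `hfin` DELETED: the containment LOWER
(child 27851) consumes — `ord₂ H(0) ≥` the order of the specialised two-variable generator — does not wait on crux 24037 `PseudoNullFiniteAtTwo`.
[cite: GreenbergLNM1716, §4 Lemma 4.2] [cite: Agboola2007, §4–§5, Thm. 2] [cite: SkinnerUrban2014, Cor. 3.2.9] [cite: GreenbergVatsal2000, §2 pp. 17–21] -/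
theorem exists_charGenerator_unr_le_of_frame {d : ℤ} (hd0 : d ≠ 0) (W : WeierstrassCurve ℚ) [W.IsElliptic]
    (C : VariableChange ℚ) (hC : C • W = cm7.quadraticTwist (d : ℚ)) (hK : IsImaginaryQuadratic K)
    (v vbar : HeightOneSpectrum (𝓞 K)) (hv : ((2 : ℕ) : 𝓞 K) ∈ v.asIdeal) (hvbar : ((2 : ℕ) : 𝓞 K) ∈ vbar.asIdeal) (hne : vbar ≠ v)
    (π : (W.baseChange K).endRing) (r : ℤ_[2]) (κ₁ κ₂ : ZpExtension K 2)
    (hκ₂ : κ₂.IsUnramifiedOutside vbar) {γ₁ γ₂ : absoluteGaloisGroup K} (hγ : ZpExtension.IsTopGeneratorPair κ₁ κ₂ γ₁ γ₂)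
    (D₂ : DualData₂ κ₁ κ₂ ↥((W.baseChange K).endEigenPrimaryTorsion 2 π r) vbar γ₁ γ₂) [Module.Finite (IwasawaAlgebra₂ 2) D₂.X]
    (D : DatumDualData κ₂ γ₂ ↥((W.baseChange K).endEigenPrimaryTorsion 2 π r)
      (Castella2018.AcSelmer.bdpData ↥((W.baseChange K).endEigenPrimaryTorsion 2 π r) 2 vbar) ∅)
    (hΓ : Finite (endInvariants (conjUnr κ₂ ↥((W.baseChange K).endEigenPrimaryTorsion 2 π r) vbar (∅ : Set (HeightOneSpectrum (𝓞 K))) γ₂ - 1))) :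
    Module.Finite (IwasawaAlgebra 2) D.X ∧ Module.IsTorsion (IwasawaAlgebra 2) D.X ∧
      ∃ H : IwasawaAlgebra 2, Module.charIdeal (IwasawaAlgebra 2) D.X = Ideal.span {H} ∧ PowerSeries.constantCoeff H ≠ 0 ∧
        Ideal.span {H} ≤ (Module.charIdeal (IwasawaAlgebra₂ 2) D₂.X).map (PowerSeries.constantCoeff (R := IwasawaAlgebra 2)) := by
  obtain ⟨hfg, hX, H, hH, hH0⟩ := LinePush.finite_isTorsion_exists_charIdeal_of_finite_endInvariants_unr D
    (exists_pow_smul_endEigenPrimaryTorsion_eq_zero (W.baseChange K) 2 π r) (isOpen_stabilizer_endEigenPrimaryTorsion (W.baseChange K) 2 π r)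
    hγ.2.2.2 hΓ
  refine ⟨hfg, hX, H, hH, hH0, ?_⟩
  rw [← hH]
  exact charIdeal_unr_le_map_constantCoeff_of_frame hd0 W C hC hK v vbar hv hvbar hne π r κ₁ κ₂ hκ₂ hγ D₂ D hX

end Frame

end Summit.BirchSwinnertonDyer.BirchSwinnertonDyer.Theorems.PrintCf2.LinePushOneSided

end
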